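import Summits.HodgeConjecture.HodgeConjecture.Theses.NoetherLefschetzOneUp
import Literature.AlgebraicGeometry.HodgeTheory.MiddleDimensionReductionHolds
import Literature.AlgebraicGeometry.HodgeTheory.ComplexConjugationHolds

/-!
# Route NoetherLefschetzOneUp — frame item `Assembly` (stmt-HodgeConjecture-14598): exact calibration

The frame item of route `NoetherLefschetzOneUp` is `Assembly := K3TypeNets → HodgeConjecture`
("it suffices to show K3-type nets"). Since the 2026-08-16 route-repair it is not pure logic: the
route file says it is to be closed by `fun h ↦ hS (h4 h)` once the two CONDITIONAL COMPLEMENT cruxes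
`FourfoldsGrantedK3Nets` (stmt-HodgeConjecture-14599: `K3TypeNets → HC(4,2)`) and
`SummitGrantedFourfolds` (stmt-HodgeConjecture-14600: `HC(4,2) →` the summit, spelled out) land.

This file records, sorry-free and unconditionally, exactly how the item sits between those cruxes:

* `noetherLefschetzOneUp_assembly_of_complements` — the planner's closing argument
  `FourfoldsGrantedK3Nets → SummitGrantedFourfolds → Assembly` (so the item closes by a one-liner the
  moment both cruxes are theorems);
* `noetherLefschetzOneUp_k3TypeNets_of_fourfoldMiddleDegree` — `HC(4,2) → K3TypeNets`: if every
  rational `(2,2)`-class on every smooth projective fourfold is algebraic, the K3-type-net inclusion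
  `span{rational (2,2)} ≤ algebraic ⊔ vertical` holds a fortiori (`Submodule.span_le`, `le_sup_left`);
* hence the CONVERSES `Assembly → FourfoldsGrantedK3Nets` and `Assembly → SummitGrantedFourfolds`,
  and the exact calibration
  `noetherLefschetzOneUp_assembly_iff : Assembly ↔ FourfoldsGrantedK3Nets ∧ SummitGrantedFourfolds`:
  the frame item is PRECISELY the conjunction of the two open complement cruxes — a proof of
  `Assembly` is a proof of both, so the item cannot close before stmt-14599 and stmt-14600 do;
* `noetherLefschetzOneUp_cruxes_iff_hodgeConjecture` — the route is tight: its three ranked cruxes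
  are jointly EQUIVALENT to the summit statement (`closes` one way; the summit implies each crux);
* `noetherLefschetzOneUp_assembly_iff_middleDegrees` — the RESIDUAL form, using the two prints the
  tree has already discharged unconditionally (existence of Hodge models `nonempty_hodgeModel_holds`,
  Serre GAGA + de Rham + Hodge decomposition; reduction to the middle dimension
  `middleDimensionReduction_holds`, Brosnan–Fang–Nie–Pearlstein Lemma 48) and `algebraicClasses_zero`:
  `Assembly ↔ (K3TypeNets → HC in the middle degree 2m of every smooth projective 2m-fold, m ≥ 1)` —
  what remains of the frame item is exactly: Lefschetz `(1,1)` on surfaces (`m = 1`, in print),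
  `HC(4,2)` for all fourfolds (`m = 2`) and the middle degree of every even dimension `≥ 6` (`m ≥ 3`),
  all granted K3-type nets.

Everything here is elementary logic over the route's definitions plus the lattice facts
`Submodule.span_le` / `le_sup_left` and the two discharged Literature theorems just named; no named-fact
hypotheses, axioms `propext`, `Classical.choice`, `Quot.sound` only.

## References

* P. Deligne, *The Hodge conjecture*, Clay Mathematics Institute (2000), §1. [Deligne2000]
* D. Arapura, *Hodge cycles and the Leray filtration*, Pacific J. Math. 319 (2022) (arXiv:2103.05038),
  Cor. 1.4–1.5. [Arapura2022]
* P. Brosnan, H. Fang, Z. Nie, G. Pearlstein, *Singularities of admissible normal functions*,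
  Invent. Math. 177 (2009), §6 Lemma 48. [BrosnanFangNiePearlstein2009]
-/

noncomputable section

-- `Summit.HodgeConjecture.HodgeConjecture.Theorems` is the mandated namespace (single-conjunct summit:
-- Sub = Summit), which `linter.dupNamespace` flags on every declaration; the lakefile turns the
-- linter off tree-wide (weak option), restated here so stand-alone elaboration is warning-free too.
set_option linter.dupNamespace false

namespace Summit.HodgeConjecture.HodgeConjecture.Theorems

open Summit.HodgeConjecture.HodgeConjecture.Theses.NoetherLefschetzOneUp

/-- **`HC(4,2)` implies `K3TypeNets`.** If every rational `(2,2)`-class on every smooth projective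
complex fourfold lies in `algebraicClasses X 2`, then for every net `f : X ⟶ ℙ²` as in `K3TypeNets`
the span of the rational `(2,2)`-classes lies in `algebraicClasses X 2`, hence in
`algebraicClasses X 2 ⊔ (vertical span)`; the fibre hypotheses are not used. Pure lattice logic
(`Submodule.span_le`, `le_sup_left`). [cite: Deligne2000, §1] -/
theorem noetherLefschetzOneUp_k3TypeNets_of_fourfoldMiddleDegree
    (h42 : ∀ ⦃X : Literature.AlgebraicGeometry.Motives.SchemeOver ℂ⦄,
      Literature.AlgebraicGeometry.Motives.IsSmoothProjective 4 X →
        ∀ c : Literature.AlgebraicGeometry.HodgeTheory.complexBetti X (2 * 2),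
          Literature.AlgebraicGeometry.HodgeTheory.IsRationalClass c →
            Literature.AlgebraicGeometry.HodgeTheory.IsOfHodgeType 4 X (2 * 2) 2 2 c →
              c ∈ Literature.AlgebraicGeometry.HodgeTheory.algebraicClasses X 2) :
    K3TypeNets := by
  unfold K3TypeNets
  intro X _f hX _hf _hT
  exact le_sup_of_le_left (Submodule.span_le.mpr fun c hc ↦ h42 hX c hc.1 hc.2)

/-- **The planner's closing argument for the frame item** (route file, item stmt-HodgeConjecture-14598:
"proved by `fun h ↦ hS (h4 h)` once FourfoldsGrantedK3Nets and SummitGrantedFourfolds land"):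
`FourfoldsGrantedK3Nets → SummitGrantedFourfolds → Assembly`. Given `K3TypeNets`, the first
complement yields the fourfold middle degree `HC(4,2)`, the second turns it into
`HodgeConjectureFor n X` for every smooth projective `X` (Hodge model and all `(p,p)`-classes).
[cite: Deligne2000, §1] -/
theorem noetherLefschetzOneUp_assembly_of_complements
    (h4 : FourfoldsGrantedK3Nets) (hS : SummitGrantedFourfolds) : Assembly := by
  unfold Assembly
  intro hK3 n X hX
  exact ⟨(hS (h4 hK3) hX).1, (hS (h4 hK3) hX).2⟩

/-- **Converse, first half: `Assembly → FourfoldsGrantedK3Nets`.** Granted `K3TypeNets`, `Assembly`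
gives the whole summit, in particular the cycle part of `HodgeConjectureFor 4 X` in degree
`4 = 2 · 2`. So the frame item is at least as strong as crux stmt-HodgeConjecture-14599.
[cite: Deligne2000, §1] -/
theorem noetherLefschetzOneUp_fourfoldsGrantedK3Nets_of_assembly (hA : Assembly) :
    FourfoldsGrantedK3Nets := by
  unfold FourfoldsGrantedK3Nets
  intro hK3 X hX c hc hpp
  exact (hA hK3 hX).2 2 c hc hpp

/-- **Converse, second half: `Assembly → SummitGrantedFourfolds`.** Granted `HC(4,2)`, `K3TypeNets`
holds a fortiori (`noetherLefschetzOneUp_k3TypeNets_of_fourfoldMiddleDegree`), so `Assembly` gives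
the summit, whose instance at `X` is literally the conclusion of `SummitGrantedFourfolds`. So the
frame item is at least as strong as crux stmt-HodgeConjecture-14600. [cite: Deligne2000, §1] -/
theorem noetherLefschetzOneUp_summitGrantedFourfolds_of_assembly (hA : Assembly) :
    SummitGrantedFourfolds := by
  unfold SummitGrantedFourfolds
  intro h42 n X hX
  have hHC := hA (noetherLefschetzOneUp_k3TypeNets_of_fourfoldMiddleDegree h42) hX
  exact ⟨hHC.1, hHC.2⟩

/-- **Exact calibration of the frame item**: `Assembly ↔ FourfoldsGrantedK3Nets ∧ SummitGrantedFourfolds`.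
The frame item `K3TypeNets → HodgeConjecture` of route NoetherLefschetzOneUp is precisely the
conjunction of its two conditional complement cruxes (stmt-HodgeConjecture-14599 and
stmt-HodgeConjecture-14600): `←` is the planner's glue, `→` uses `HC(4,2) → K3TypeNets`.
Consequently the item closes exactly when both cruxes close, and not before.
[cite: Deligne2000, §1] [cite: BrosnanFangNiePearlstein2009, §6 Lemma 48] -/
theorem noetherLefschetzOneUp_assembly_iff :
    Assembly ↔ FourfoldsGrantedK3Nets ∧ SummitGrantedFourfolds :=
  ⟨fun hA ↦ ⟨noetherLefschetzOneUp_fourfoldsGrantedK3Nets_of_assembly hA,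
    noetherLefschetzOneUp_summitGrantedFourfolds_of_assembly hA⟩,
    fun h ↦ noetherLefschetzOneUp_assembly_of_complements h.1 h.2⟩

/-- **Sanity: the summit implies the frame item** (`Assembly` is a consequence of `HodgeConjecture`,
as every item of a route must be; here by discarding the hypothesis `K3TypeNets`).
[cite: Deligne2000, §1] -/
theorem noetherLefschetzOneUp_assembly_of_hodgeConjecture (h : _root_.HodgeConjecture) : Assembly := by
  unfold Assembly
  intro _hK3
  exact h

/-- **The route is tight: its three ranked cruxes are jointly equivalent to the summit.**
`K3TypeNets ∧ FourfoldsGrantedK3Nets ∧ SummitGrantedFourfolds ↔ HodgeConjecture`: `→` is the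
route's deciding theorem `closes`; `←` because the summit gives `HC(4,2)`, hence `K3TypeNets`
(`noetherLefschetzOneUp_k3TypeNets_of_fourfoldMiddleDegree`), and gives the conclusions of both
conditional complements outright. No crux of the route over-claims beyond the Hodge conjecture.
[cite: Deligne2000, §1] [cite: Arapura2022, Cor. 1.4] -/
theorem noetherLefschetzOneUp_cruxes_iff_hodgeConjecture :
    (K3TypeNets ∧ FourfoldsGrantedK3Nets ∧ SummitGrantedFourfolds) ↔ _root_.HodgeConjecture := by
  constructor
  · rintro ⟨hK3, h4, hS⟩
    exact closes hK3 h4 hS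
  · intro h
    have h42 : ∀ ⦃X : Literature.AlgebraicGeometry.Motives.SchemeOver ℂ⦄,
        Literature.AlgebraicGeometry.Motives.IsSmoothProjective 4 X →
          ∀ c : Literature.AlgebraicGeometry.HodgeTheory.complexBetti X (2 * 2),
            Literature.AlgebraicGeometry.HodgeTheory.IsRationalClass c →
              Literature.AlgebraicGeometry.HodgeTheory.IsOfHodgeType 4 X (2 * 2) 2 2 c →
                c ∈ Literature.AlgebraicGeometry.HodgeTheory.algebraicClasses X 2 :=
      fun X hX c hc hpp ↦ (h hX).2 2 c hc hpp
    refine ⟨noetherLefschetzOneUp_k3TypeNets_of_fourfoldMiddleDegree h42, ?_, ?_⟩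
    · unfold FourfoldsGrantedK3Nets
      intro _hK3
      exact h42
    · unfold SummitGrantedFourfolds
      intro _h42 n X hX
      exact ⟨(h hX).1, (h hX).2⟩

/-- **Residual form of the frame item.** Using the tree's unconditional theorems
`nonempty_hodgeModel_holds` (every smooth projective complex variety has a Hodge model: Serre GAGA,
de Rham, Hodge decomposition) and `middleDimensionReduction_holds` (Brosnan–Fang–Nie–Pearlstein 2009,
Lemma 48: the Hodge conjecture reduces to the middle degree of even-dimensional varieties), together
with `algebraicClasses_zero` for dimension `0`, the frame item `Assembly : K3TypeNets → HodgeConjecture`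
is EQUIVALENT to: `K3TypeNets →` every rational `(m,m)`-class on every smooth projective complex
`2m`-fold, `m ≥ 1`, is algebraic. The residue is thus Lefschetz `(1,1)` on surfaces (`m = 1`),
`HC(4,2)` (`m = 2`, crux FourfoldsGrantedK3Nets granted K3-type nets) and the open middle degree of
every even dimension `≥ 6` (`m ≥ 3`, inside crux SummitGrantedFourfolds).
[cite: BrosnanFangNiePearlstein2009, §6 Lemma 48] [cite: Deligne2000, §1] -/
theorem noetherLefschetzOneUp_assembly_iff_middleDegrees :
    Assembly ↔
      (K3TypeNets → ∀ ⦃m : ℕ⦄ ⦃X : Literature.AlgebraicGeometry.Motives.SchemeOver ℂ⦄, 1 ≤ m →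
        Literature.AlgebraicGeometry.Motives.IsSmoothProjective (2 * m) X →
          ∀ c : Literature.AlgebraicGeometry.HodgeTheory.complexBetti X (2 * m),
            Literature.AlgebraicGeometry.HodgeTheory.IsRationalClass c →
              Literature.AlgebraicGeometry.HodgeTheory.IsOfHodgeType (2 * m) X (2 * m) m m c →
                c ∈ Literature.AlgebraicGeometry.HodgeTheory.algebraicClasses X m) := by
  constructor
  · intro hA hK3 m X _hm hX c hc hpp
    exact (hA hK3 hX).2 m c hc hpp
  · intro h
    unfold Assembly
    intro hK3 n X hX
    refine ⟨Literature.AlgebraicGeometry.HodgeTheory.nonempty_hodgeModel.nonempty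
      Literature.AlgebraicGeometry.HodgeTheory.nonempty_hodgeModel_holds hX, ?_⟩
    refine Literature.AlgebraicGeometry.HodgeTheory.middleDimensionReduction_holds ?_ hX
    intro m Y hY c hc hpp
    rcases Nat.eq_zero_or_pos m with rfl | hm
    · -- codimension `0`: `algebraicClasses Y 0 = ⊤`
      exact Literature.AlgebraicGeometry.HodgeTheory.hodgeConjectureFor_codim_zero c
    · exact h hK3 hm hY c hc hpp

end Summit.HodgeConjecture.HodgeConjecture.Theorems

end
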